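import Mathlib
import HarnessLib
import HarnessLib.Audit
import Summits.CriticalPhenomena.Statement
import Literature.Probability.RandomPlanarGeometry.LoewnerDescription
import Literature.Probability.RandomPlanarGeometry.ChordalReversibility
import Literature.Probability.RandomPlanarGeometry.CaratheodoryHalfPlaneProofs
import HarnessLib.Audit.Status.Attr

/-!
Route: SAWReversalUpgrade

DORMANT since 2026-08-24T05:02:46Z (reconciler: no traction for 6.6 d (last activity item-proof-filed at 2026-08-17T15:07:34Z); parked, not closed — `ledger route dormant route-CriticalPhenomena-SAWReversalUpgrade --off` to reactivate) — unstaffed, not closed; items shared with open routes are served there. `ledger route dormant <id> --off` reactivates.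

# Route SAWReversalUpgrade — reversibility closes the fjords — exact time reversal + Sheffield–Sun
make forward driving convergence suffice, no precompactness crux

It suffices to show X = ForwardDriving ∧ NoDeepReturn ∧ PathUpgradeR. ForwardDriving (K1): in every
Dobrushin domain (D; a, b), the
capacity-parametrised Loewner driving function — read through a chordal uniformizer φ of D — of the
CANONICALLY BOUNDARY-ATTACHED critical
SAW η_δ = att(γ_δ) converges in law, uniformly on [0,T] for every T, to √(8/3)·B; nothing is asked
about tightness of the curves.
NoDeepReturn (K3): after first reaching distance ε from its starting prime end a, the critical SAW
re-enters the r-ball at a with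
probability ≤ η for some r = r(D, ε, η) > 0 and all small δ (the end point b is covered by exact
time reversal). PathUpgradeR (K2, repaired 2026-08-17):
chordal driving convergence for BOTH parametrisation directions PLUS two-endpoint tightness (no deep
return to a, no escape from b —
NoDeepReturn's shape, supplied for att(γ) by NoDeepReturn in D and in D.swap through the support
AttachNoReturn) ⇒ convergence in law of the
curves for the uniform-modulo-reparametrisation metric, with no a-priori precompactness
(Sheffield–Sun 2012 Thm 1.4 / Cor 1.5, generic
interior targets, + a chordal-to-radial tail lemma), in the tree's `ConvergesInLawToSLE`. (The
endpoint-only form first filed — SS12 Cor 1.7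
as literally stated — was refuted on paper by an N-curve witness, REFUTATION.md on
stmt-CriticalPhenomena-18005; the theorem needs the ends pinned.)
The backward direction is FREE: x_c^|γ| is invariant under γ ↦ γ^R, so ForwardDriving in the swapped
domain D.swap is backward
driving convergence in D (supports LawReversal + AttachReversal, used in `closes`); no RSW /
Aizenman–Burchard / Kemppainen–Smirnov input appears anywhere.
Lean: `ForwardDriving ∧ NoDeepReturn ∧ PathUpgradeR`

## Assembly
Real proof in glue.lean (`closes`, sorry-free, elaborated): fix (D; a, b) and an endpoint
approximation; take uniformizers φ of D and φ' of
D.swap (`MarkedDomain.exists_isChordalUniformizing_holds`, proved Riemann–Carathéodory);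
AttachmentExists gives eventually-standard att (for
D) and att' (for D.swap, endpoints swapped by EndpointApproxSwap); ForwardDriving twice (D and
D.swap); LawReversal + AttachReversal turn the D.swap
instance into backward driving convergence of att (the reversal step, ~15 lines of the proof);
PathUpgradeR (with LawEventuallyProbability, discrete measurability, and the endpoint tightness of
att from AttachNoReturn fed NoDeepReturn for D and D.swap) gives
`ConvergesInLawToSLE (8/3) D (mk ∘ att) law`; FaithfulOfNoReturn (fed NoDeepReturn for D and for
D.swap) and LawTransfer move the
convergence from att(γ) to γ.curve, which is the conjunct. Every crux is consumed; the eight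
supports are routine and typed.

Rationale: WHY THIS LINE. Every open route on this conjunct carries a precompactness crux (EventualTight
stmt-1881, HexTight, SimpleSubseqLimits, LimitExists,
LimitsDescribable stmt-4481 …), and that crux is itself open: no annulus-crossing bound for the
x_c-SAW is in print (KemppainenSmirnov2017
§4 treats FK, percolation, harmonic explorer, LERW — not SAW; DuminilCopinKozmaYadin2014 Problem 10,
non-space-filling at x_c, is open).
SheffieldSun2012 (arXiv:1003.4675, Thm 1.1 / 1.4 / Cor 1.5) proved that for κ < 8 driving-function
convergence IN BOTH DIRECTIONS (with respect to
generic interior targets) already gives uniform path convergence — their endpoint-only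
simplification for κ ≤ 4 (Thm 1.2(ii) / Cor 1.7) is false as
literally stated (N-curve: a middle strand after a near-approach of b and before a re-approach of a
is invisible from both ends; refuter's
REFUTATION.md on stmt-CriticalPhenomena-18005, 2026-08-17), and is replaced here by two-endpoint
tightness, which this route's NoDeepReturn
supplies at both prime ends — and remarked that this makes the observable step sufficient "for
models with a built-in time-reversal symmetry"
(their list: Ising, FK, percolation, GFF). The critical SAW is the cleanest such model — its Gibbs
weight is exactly reversal-invariant
(LawlerSchrammWerner2004SAW §2.2, §3.1) — yet none of the 16 papers citing SheffieldSun2012 and none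
of this summit's 60 routes / 154 cards
uses it. The line imports: Loewner-chain theory (driving functions, the tree's `drivingFunction`),
the SLE_8/3 restriction martingales of
LawlerSchrammWerner2003Restriction Prop 5.3 as the identification engine for K1, and an elementary
conformal device (the angular squeeze
A_ε: z = re^(iθ) ↦ re^(i(ε+(1−2ε/π)θ)) in uniformizing coordinates, which commutes with dilations
AND with the swap z ↦ −1/z) to make the
boundary attachment canonical and reversal-equivariant for arbitrary Jordan domains and arbitrary
endpoint approximations.

RANKED CRUXES. #2 ForwardDriving (crux) — for every Dobrushin domain, endpoint approximation,
chordal uniformizer φ and every eventually-standard boundary attachment att (trim the SAW polyline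
at its visits of a, b; push it into D by the angular squeeze A_ε, ε = min δ 1/2, in φ-coordinates;
join a and b along the boundary-most crossings of the straight access segment / ray), the driving
function of att(γ_δ) through φ restricted to [0,T] converges in law (bounded continuous test
functions on C([0,T])) to √(8/3)B|[0,T], for every T. [difficulty: open-problem] (why it might fail:
needs an approximately conformally covariant martingale observable for the Z² SAW (DCS12 §4): the
exact avoidance martingale converges only if the 5/8 restriction law holds uniformly in slit
domains; boundary creeping at mesoscopic capacity steps could also destroy C-tightness of W^δ.)
[SheffieldSun2012, LawlerSchrammWerner2004, LawlerSchrammWerner2003Restriction, Kennedy2008Driving,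
DuminilCopinSmirnov2012]
#3 NoDeepReturn (crux) — for every Dobrushin domain (D; a, b) and endpoint approximation, for every
ε > 0 and η > 0 there is r > 0 such that for all small δ the critical SAW law gives mass ≤ η to
walks that are at distance ≥ ε from a = D.pt 0 at some time and at distance ≤ r from a at a later
time (no deep return to the starting prime end; the terminal end follows by reversal). [difficulty:
L] (why it might fail: no SAW surgery beats the reconnection entropy (removing an excursion of
length 2R saves x_c^(-2R/δ), re-joining along ∂B_R costs x_c^(πR/δ)); only Hammersley–Welsh e^(-c√n)
unfolding bounds exist; fjords of D accumulating at a could trap returns at every scale.)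
[DuminilCopinKozmaYadin2014, DuminilCopinHammond2013, LawlerSchrammWerner2004SAW,
KemppainenSmirnov2017]
#4 PathUpgradeR (crux) — repaired PathUpgrade: random simple curves X_δ in closure D from D.pt 0 to
D.pt 1 (interior in D) under eventually-probability laws P_δ, whose driving functions through a
uniformizer φ of D AND whose reversals' driving functions through a uniformizer φ' of D.swap both
converge in law on every [0,T] to √(8/3)B, AND which have no deep return to a (H6) and no escape
from b after an r-close approach (H7) (∀ ε η ∃ r, eventually P_δ ≤ η, NoDeepReturn's shape),
converge in law (CurveClass ℂ) to chordal SLE_8/3 in D (`ConvergesInLawToSLE`). [difficulty: XL]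
(why it might fail: not in print: SS12 Thm 1.4/Cor 1.5 need R_x/L_x convergence for dense interior
x; the new step 'chordal driving + endpoint tightness ⇒ R_x' must control the tail seen from x, and
SS12's x-avoiding / time-separated set-up must transport to arbitrary simple X_δ in a Jordan
domain.) [SheffieldSun2012, Zhan2008Reversibility, KemppainenSmirnov2017, Karrila2024, Lawler2005]
#9 AttachNoReturn (support) — endpoint tightness passes to the attached curve: under NoDeepReturn at
a for (D; a, b) and at b for (D.swap; b, a), every eventually-standard att has, for every ε η > 0,
some r > 0 with SAW-probability ≤ η (small δ) of an (ε, r) deep return of att(γ) to a and of an (r,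
ε) escape from b (access segment ⊂ B(a, o(1)), exit ray ⊂ B(b, o(1)), squeeze displacement → 0
uniformly, the attached arc is traversed in polyline order, so an att-event is an (ε/2, 2r)-event of
the polyline or of the reversed polyline; reversal preserves the law). [difficulty: provable-now]
[Lawler2005, SheffieldSun2012, LawlerSchrammWerner2004SAW]
#9 LawReversal (support) — exact time-reversal symmetry of the critical SAW law (the tree's
`lawAt_map_sawReverse` at x = x_c, barrier file SupercriticalSAWSpaceFillingReversible), in
transport form: for every discrete domain and every real function g on walks v → u, ∫ g d law(v→u) =
∫ g∘reverse d law(u→v) (reversal is a weight-preserving bijection of DomainSAW: x_c^|γ^R| =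
x_c^|γ|). [difficulty: provable-now] [LawlerSchrammWerner2004SAW]
#9 AttachReversal (support) — reversal-equivariance of the canonical attachment: if c is standard
for (D, φ) and the polyline of γ, and c' is standard for (D.swap, φ') and the polyline of the
reversed walk, then mk c' = reverse (mk c) in CurveClass ℂ (the angular squeeze commutes with z ↦
−1/z and with dilations; uniformizers of D and D.swap differ by z ↦ −λ/z,
`IsChordalUniformizing.exists_eq_trans_smul_holds`; two injective curves with the same trace and
endpoints define the same class). [difficulty: provable-now] [LawlerSchrammWerner2004SAW,
SheffieldSun2012]
#9 FaithfulOfNoReturn (support) — under NoDeepReturn at a for (D; a, b) and at b (= NoDeepReturn at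
the start for D.swap), the standard attachment is faithful: for every ε > 0 the SAW-probability that
att(γ) and γ.curve are ε-apart in CurveClass ℂ tends to 0 (trimmed and cut pieces are short; the
squeeze A_(min δ 1/2) tends to the identity uniformly on closure D by Carathéodory continuity).
[difficulty: provable-now] [SheffieldSun2012, Lawler2005]
#9 AttachmentExists (support) — for every Dobrushin domain, uniformizer and endpoint approximation
there is an attachment att that is standard for all small δ (the prescribed range is a simple arc
from D.pt 0 to D.pt 1 with interior in D; parametrise it injectively). [difficulty: provable-now]
[Lawler2005, SheffieldSun2012]
#9 LawTransfer (support) — Slutsky on CurveClass ℂ: if X_δ → SLE_κ in law (`ConvergesInLawToSLE`)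
and dist(X_δ, Y_δ) → 0 in P_δ-probability (P_δ eventually probability, Y_δ eventually
a.e.-measurable) then Y_δ → SLE_κ in law. [difficulty: provable-now] [Lawler2005,
KemppainenSmirnov2017]
#9 LawEventuallyProbability (support) — for all small δ the critical SAW law of Ω_δ from a_δ to b_δ
is a probability measure (endpoints joined ⇒ positive finite weight; proved inline in route
SAWRenewalTightness' deciding theorem, to be banked as a lemma). [difficulty: provable-now]
[LawlerSchrammWerner2004SAW, DuminilCopinSmirnov2012]
#9 EndpointApproxSwap (support) — an endpoint approximation of (D; a, b) is an endpoint
approximation of (D.swap; b, a) (reachability is symmetric; `pt_swap_zero/one`). [difficulty: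
provable-now] [LawlerSchrammWerner2004SAW]

TWO-LAYER PLAN. ForwardDriving ⇐ DriverCharacterisation (continuum: a continuous driver all of whose
LSW03 restriction functionals Φ'_(g_t A)(W_t)^(5/8) are
martingales is √(8/3)B — Lévy via `isSLELaw_of_isLocalMartingale_driving_of_lt_four`) →
AvoidanceObservable (the exact conditional
avoidance martingale of the SAW converges to that functional, uniformly along the exploration) →
LSWRecipe (Loewner sampling at mesoscopic
capacity steps + Skorokhod embedding) → ForwardDriving. NoDeepReturn ⇐ ScaleRatio (one-scale
decoupling: mass of a return to 4^(−j−1)ε ≤ ρ ×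
mass of a return to 4^(−j)ε) → LawEventuallyProbability → NoDeepReturn (geometric induction).
PathUpgradeR ⇐ RadialFromChordal (chordal driving convergence on every [0,T] + the endpoint
tightness at the target ⇒ radial R_x convergence in law for every interior x: hull extent by
Carathéodory kernel convergence + SLE transience
`tendsto_norm_sleTrace_atTop`, tail confined to a small ball at the target by (H7) (resp. (H6) for
the reversal), whose radial capacity and radial-driving
oscillation seen from x are small by harmonic measure) → SS12Generic (SheffieldSun2012 Thm 1.4 / Cor
1.5 transported to CurveClass ℂ in a Jordan
domain) → PathUpgradeR. The first two were shipped as birth skeletons (bc/); the old PathUpgrade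
skeleton (SSTightness → TightPlusDrivingIdentifies)
is retired with the replaced item.

KILL CRITERIA. A Dobrushin domain + endpoint approximation where returns to the r-ball at a keep
probability ≥ η for every r (refuted:NoDeepReturn) kills
the attachment device — pivot: restrict to endpoint approximations within O(δ) of a flat boundary
piece and add an endpoint-universality
crux (shared with SAWCircleScreening), or close. ForwardDriving refuted (e.g. a subsequential
driving limit with ⟨W⟩_t ≠ (8/3)t, or
non-Brownian) refutes the conjunct's prediction itself for that domain — informative either way.
PathUpgradeR refuted (a family with bidirectional driving convergence AND two-endpoint
tightness that does not converge strongly) must, by SS12 Thm 1.4, break R_x or L_x convergence for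
some interior x, i.e. the chordal-to-radial tail
lemma: that kills the 'no precompactness crux' thesis — close, or pivot to an interior-target
(radial) driving crux, which is no longer the bare
observable step. (The endpoint-only PathUpgrade WAS refuted on paper, 2026-08-17; repaired as
PathUpgradeR + AttachNoReturn, rev 2.) EventualTight (stmt-1881) proved elsewhere does NOT moot the
route (it
still needs identification); SubseqIdentification + EventualTight proved elsewhere moots it.

NOT DECOMPOSED YET. The martingale observable behind ForwardDriving (which observable: exact
avoidance ratios vs a DCS-type parafermion on a solvable
neighbour + universality) — layer-2, after the birth skeleton's DriverCharacterisation closes; the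
describability lemma "simple curves are
Loewner traces" and the measurability of path-space test functionals (inside PathUpgradeR /
ForwardDriving provers' files); the rate in
NoDeepReturn (qualitative on purpose: ∃ r).

CHEAPEST FALSIFIER. (i) Typing: a large-δ or spike-at-a witness against AttachmentExists /
FaithfulOfNoReturn (all attachment clauses are `∀ᶠ δ`; the polyline
is trimmed at visits of a, b and pushed off ∂D, so the L-shaped-corner-at-a configuration — an edge
of Ω_δ through the marked point for
every δ = 1/k — is absorbed; checked by hand, not by kernel). (ii) Numerics already run in print:
Kennedy2008Driving computed the driving
process of half-plane SAW samples and found Brownian statistics with κ ≈ 8/3 (consistent with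
ForwardDriving). (iii) `lean check` of the
deciding theorem: done, rc 0, sorry-free (again for rev 2). (iv) The refuter's N-curve / randomised
N-curve surgery (REFUTATION.md on
stmt-CriticalPhenomena-18005) is the standing test for every endpoint-only variant; PathUpgradeR's
(H6)(H7) exclude it. The cheapest remaining attack is a
MID-curve surgery on an SLE_8/3 sample invisible from b AND from a at finite capacity: it needs a
pinched fjord of the past (and of the future), whose
Hausdorff limit — for κ ≤ 4 the filled hull is the curve, so Carathéodory convergence of hulls is
Hausdorff convergence — would be a double point of
SLE_8/3; so such a witness must shrink with δ and cannot move d_strong.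

NUMBERS. κ = 8/3, boundary exponent 5/8 (restriction martingale h_t'(W_t)^(5/8), LSW03 Prop 5.3);
SS12 Thm 1.4 / Cor 1.5: κ < 8 with interior
observation points (κ = 8/3 ≤ 4: simple limit, Zhan reversibility); push-in angle ε = min δ 1/2 <
π/2; items at open: 11 (3 cruxes, 7 supports, 1 assembly); after the 2026-08-17 repair (rev 2): 12
active (3 cruxes, 8 supports, 1 assembly), 2 replaced.

DEFINITION REQUESTS. None. Used: drivingFunction / IsChordalUniformizing / ConvergesInLawToSLE /
TendstoLaw / CurveClass.reverse / MarkedDomain.swap /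
sleDriving / Process.preWienerMeasure / ConformalEquiv.boundaryExtension (all `lean search
--decl`-checked; Sketch.lean rc 0).

Novelty: Searches (2026-08-17): `lit citing arXiv:1003.4675` (16 citers: GFF level lines, LERW on planar
graphs, κ-continuity, Loewner energy — no
SAW); idea-card index of the sub (154 cards) grepped for Sheffield–Sun / strong path / bidirectional
/ time-reversal (0 mechanism hits;
`pivot-jump-process-ergodicity` (falsified) and `restriction-rigidity-bp` use reversibility only as
a rigidity axiom); all 66 Theses files
grepped (reversal appears as an auxiliary symmetry in SAWTargetMonotonicity, SAWExcursionCardy, as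
an axiom in SAWZoomRigidity /
SAWRestrictionRigidity; never with Loewner upgrading); `ledger negatives` (11; none on driving
functions); lit search / galaxy (daemon and
remote APIs rate-limited this session — recorded in NOTES).
Nearest prior art found: SheffieldSun2012 §1 p.3 ("for models with a built-in time-reversal symmetry
this step is sufficient"; examples
Ising, FK, percolation, GFF); route-CriticalPhenomena-SAWTipEnvironment (driving function as
martingale transform; still carries
EventualTight stmt-1881 + LimitsDescribable stmt-4481); route-CriticalPhenomena-SAWRenewalTightness
(Kesten renewal as tightness engine);
card hyperspace-capacity-connectedness (variant: Hausdorff-hyperspace compactness, keeps a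
non-retracing crux).
Delta: the first line on this conjunct in which precompactness is not a crux at all — exact reversal
symmetry of x_c^|γ| supplies the
second Loewner direction, Sheffield–Sun supplies compactness, and a reversal-equivariant conformal
attachment  [refs: 1003.4675, SheffieldSun2012]

Barriers (technique_class: time-reversal, loewner-upgrade, driving-convergence): - technique_class: time-reversal, loewner-upgrade, driving-convergence
- Literature.Barriers.CriticalPhenomena.ParafermionicHalfCauchyRiemann: not in the class — no
discrete holomorphicity is used or claimed; the identification engine proposed for ForwardDriving is
the exact avoidance martingale + LSW03 restriction martingales, which need no vertex relation.
- Literature.Barriers.CriticalPhenomena.NienhuisWeightsExcludeVertexSAW: same — nothing is asked of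
an exact local linear relation on Z² (`not_hasExactVertexRelationZ2` untouched).
- Literature.Barriers.CriticalPhenomena.SAWNotKineticallyGrown: the line never treats the SAW as a
consistent kinetic family; it uses Doob martingales of conditional probabilities under the fixed
finite-volume Gibbs law and its exact domain-Markov / reversal symmetries, legal for any measure
(`KineticSAW.IsConsistent` is not assumed).
- Literature.Barriers.CriticalPhenomena.SAWNoUnitaryCFT: no CFT, reflection positivity or Virasoro
input; c = 0 enters only through κ = 8/3 in the restriction exponent 5/8.
- Literature.Barriers.CriticalPhenomena.SupercriticalSAWSpaceFilling: every item is at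
`criticalFugacity`; NoDeepReturn and ForwardDriving are false for x > x_c (space-filling),
consistent with the pinning — the route does not claim robustness in x.
- Literature.Barriers.CriticalPhenomena.GridSAWCountingSharpPComplete: no exact counting or closed
formula is used; all statements are qualitative limits of ratios.
- Literature.Barriers.CriticalPhe

History (route lifecycle, newest last):
- 2026-08-17T07:31:06Z · rev 2: restated PathUpgrade (stmt-CriticalPhenomena-18005), Assembly (stmt-CriticalPhenomena-18013) — repair (route-repair, refuted-misstated): PathUpgrade (stmt-CriticalPhenomena-18005) refuted ON PAPER by refuter-rattack-stmt-CriticalPhenomena-18005-0 (REFUTAT (planner-rrefute-CriticalPhenomena-SAWReversalU-75a70f8b-0)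
- 2026-08-24T05:02:46Z · DORMANT — reconciler: no traction for 6.6 d (last activity item-proof-filed at 2026-08-17T15:07:34Z); parked, not closed — `ledger route dormant route-CriticalPhenomena-S (operator:999:3071044)

sub-problem: SAWScalingLimit · status: dormant · opened planner-plan-novel-CriticalPhenomena-SAWScaling-8a38611a-v2-g20-0 2026-08-17T06:28:26Z · rev 3 · ledger route-CriticalPhenomena-SAWReversalUpgrade
GENERATED by the gate from the ledger (D-0016/17). Provers cite these decls: `theorem foo : Summit.CriticalPhenomena.SAWScalingLimit.Theses.SAWReversalUpgrade.<Decl> := …` in Summits/CriticalPhenomena/SAWScalingLimit/Theorems/<Name>.lean.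
-/

namespace Summit.CriticalPhenomena.SAWScalingLimit.Theses.SAWReversalUpgrade

open scoped BigOperators Topology Manifold Classical MeasureTheory ProbabilityTheory Matrix InnerProductSpace ComplexConjugate ContinuousMap
open Filter Set Function TopologicalSpace MeasureTheory

attribute [summit_statement] _root_.SAWScalingLimit

/-- item stmt-CriticalPhenomena-18003 · crux · rank 2 · open · by planner
why it might fail: needs an approximately conformally covariant martingale observable for the Z² SAW (DCS12 §4): the exact avoidance martingale converges only if the 5/8 restriction law holds uniformly in slit domains; boundary creeping at mesoscopic capacity steps could also destroy C-tightness of W^δ.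
sources: SheffieldSun2012, LawlerSchrammWerner2004, LawlerSchrammWerner2003Restriction, Kennedy2008Driving, DuminilCopinSmirnov2012
[crux] for every Dobrushin domain, endpoint approximation, chordal uniformizer φ and every
eventually-standard boundary attachment att (trim the SAW polyline at its visits of a, b; push it
into D by the angular squeeze A_ε, ε = min δ 1/2, in φ-coordinates; join a and b along the
boundary-most crossings of the straight access segment / ray), the driving function of att(γ_δ)
through φ restricted to [0,T] converges in law (bounded continuous test functions on C([0,T])) to
√(8/3)B|[0,T], for every T. [difficulty: open-problem] -/
@[route_item "route-CriticalPhenomena-SAWReversalUpgrade", crux]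
def ForwardDriving : Prop :=
  ∀ (D : Literature.Probability.RandomPlanarGeometry.DobrushinDomain) (a b : ℝ → Literature.Probability.LatticeModels.Site 2), Literature.Probability.RandomPlanarGeometry.SAW.IsEndpointApprox D a b → ∀ (φ : Literature.Probability.RandomPlanarGeometry.ConformalEquiv UpperHalfPlane.upperHalfPlaneSet D.carrier), D.IsChordalUniformizing φ → ∀ (att : ((δ : ℝ) → Literature.Probability.RandomPlanarGeometry.SAW.DomainSAW (D).carrier δ (a δ) (b δ) → Literature.Probability.RandomPlanarGeometry.Curve ℂ)), (∀ᶠ δ in (nhdsWithin (0:ℝ) (Set.Ioi 0)), ∀ γ : Literature.Probability.RandomPlanarGeometry.SAW.DomainSAW (D).carrier δ (a δ) (b δ), (let a₁ := (D).pt 0; let b₁ := (D).pt 1; let P₁ : C(unitInterval, ℂ) := (γ.walk.toCurve (Literature.Probability.LatticeModels.meshPoint δ)); let R₁ := fun u : ℝ => P₁ (Set.projIcc (0:ℝ) 1 zero_le_one u); let φ₁ := (φ).boundaryExtension; let ψ₁ := Function.invFunOn φ₁ {z : ℂ | 0 ≤ z.im}; let e₁ : ℝ := min δ (1/2); let A₁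 := fun z : ℂ => (‖z‖ : ℂ) * Complex.exp (Complex.I * ((e₁ : ℂ) + (1 - 2 * (e₁ : ℂ) / (Real.pi : ℂ)) * (Complex.arg z : ℂ))); let Z₁ := fun u : ℝ => @ite ℂ (R₁ u = b₁) (Classical.propDecidable _) b₁ (φ₁ (A₁ (ψ₁ (R₁ u)))); let i₁ := sSup ({(0:ℝ)} ∪ {u | u ∈ Set.Icc (0:ℝ) 1 ∧ R₁ u = a₁}); let j₁ := sInf ({(1:ℝ)} ∪ {u | u ∈ Set.Icc (0:ℝ) 1 ∧ R₁ u = b₁}); let M₁ := Z₁ '' Set.Icc i₁ j₁; let p₁ := A₁ (ψ₁ (R₁ i₁)); let q₁ := A₁ (ψ₁ (R₁ j₁)); let s₁ := sInf {s | s ∈ Set.Ioc (0:ℝ) 1 ∧ φ₁ ((s : ℂ) * p₁) ∈ M₁}; let r₁ := sSup ({(1:ℝ)} ∪ {r | 1 ≤ r ∧ R₁ j₁ ≠ b₁ ∧ φ₁ ((r : ℂ) * q₁) ∈ M₁}); let u₁ := sInf {u | u ∈ Set.Icc i₁ j₁ ∧ Z₁ u = φ₁ ((s₁ : ℂ) *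 p₁)}; let v₁ := sSup ({u | u ∈ Set.Icc i₁ j₁ ∧ R₁ j₁ = b₁ ∧ u = j₁} ∪ {u | u ∈ Set.Icc i₁ j₁ ∧ R₁ j₁ ≠ b₁ ∧ Z₁ u = φ₁ ((r₁ : ℂ) * q₁)}); let S₁ := ((({a₁, b₁} ∪ ((fun s : ℝ => φ₁ ((s : ℂ) * p₁)) '' Set.Ioc 0 s₁)) ∪ (Z₁ '' Set.Icc u₁ v₁)) ∪ ((fun r : ℝ => φ₁ ((r : ℂ) * q₁)) '' {r | r₁ ≤ r ∧ R₁ j₁ ≠ b₁})); Function.Injective (att δ γ) ∧ (att δ γ).source = a₁ ∧ (att δ γ).target = b₁ ∧ (∀ t : unitInterval, (att δ γ) t = a₁ ∨ (att δ γ) t = b₁ ∨ (att δ γ) t ∈ (D).carrier) ∧ (u₁ < v₁ → Set.range (att δ γ) = S₁) ∧ (¬ u₁ < v₁ → Set.range (att δ γ) = {a₁, b₁} ∪ ((fun y : ℝ => φ₁ (Complex.I * (y : ℂ))) '' Set.Ioi 0)))) → ∀ T : NNReal, Literature.Probability.RandomPlanarGeometry.TendstoLaw (fun δ (γ : Literature.Probability.RandomPlanarGeometry.SAW.DomainSAW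 D.carrier δ (a δ) (b δ)) => ((⟨Literature.Probability.RandomPlanarGeometry.drivingFunction (φ) (Literature.Probability.RandomPlanarGeometry.CurveClass.mk (att δ γ)), Literature.Probability.RandomPlanarGeometry.continuous_drivingFunction (φ) (Literature.Probability.RandomPlanarGeometry.CurveClass.mk (att δ γ))⟩ : C(NNReal, ℝ)).restrict (Set.Icc (0:NNReal) T))) (fun δ => Literature.Probability.RandomPlanarGeometry.SAW.law (D).carrier δ (a δ) (b δ)) (fun ω : NNReal → ℝ => ((⟨Literature.Probability.RandomPlanarGeometry.sleDriving ((8:NNReal)/3) ω, Literature.Probability.RandomPlanarGeometry.continuous_sleDriving ((8:NNReal)/3) ω⟩ : C(NNReal, ℝ)).restrict (Set.Icc (0:NNReal) T))) Literature.Probability.Process.preWienerMeasure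

/-- item stmt-CriticalPhenomena-18004 · crux · rank 3 · open · by planner
why it might fail: no SAW surgery beats the reconnection entropy (removing an excursion of length 2R saves x_c^(-2R/δ), re-joining along ∂B_R costs x_c^(πR/δ)); only Hammersley–Welsh e^(-c√n) unfolding bounds exist; fjords of D accumulating at a could trap returns at every scale.
sources: DuminilCopinKozmaYadin2014, DuminilCopinHammond2013, LawlerSchrammWerner2004SAW, KemppainenSmirnov2017
[crux] for every Dobrushin domain (D; a, b) and endpoint approximation, for every ε > 0 and η > 0
there is r > 0 such that for all small δ the critical SAW law gives mass ≤ η to walks that are at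
distance ≥ ε from a = D.pt 0 at some time and at distance ≤ r from a at a later time (no deep return
to the starting prime end; the terminal end follows by reversal). [difficulty: L] -/
@[route_item "route-CriticalPhenomena-SAWReversalUpgrade", crux]
def NoDeepReturn : Prop :=
  ∀ (D : Literature.Probability.RandomPlanarGeometry.DobrushinDomain) (a b : ℝ → Literature.Probability.LatticeModels.Site 2), Literature.Probability.RandomPlanarGeometry.SAW.IsEndpointApprox D a b → (∀ ε : ℝ, 0 < ε → ∀ η : ℝ, 0 < η → ∃ r : ℝ, 0 < r ∧ ∀ᶠ δ in (nhdsWithin (0:ℝ) (Set.Ioi 0)), Literature.Probability.RandomPlanarGeometry.SAW.law (D).carrier δ (a δ) (b δ) {γ | ∃ s t : unitInterval, s < t ∧ ε ≤ dist (γ.walk.toCurve (Literature.Probability.LatticeModels.meshPoint δ) s) ((D).pt 0) ∧ dist (γ.walk.toCurve (Literature.Probability.LatticeModels.meshPoint δ) t) ((D).pt 0) ≤ r} ≤ ENNReal.ofReal η)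

/-- item stmt-CriticalPhenomena-18055 · crux · rank 4 · closed · proved by Summit.CriticalPhenomena.SAWScalingLimit.Theorems.PathUpgradeR_proof @ 472c3655c2b5 (prover) · by planner
why it might fail: Not in print: SS12 Thm 1.4/Cor 1.5 need R_x/L_x convergence for dense interior x; the new step 'chordal driving + endpoint tightness ⇒ R_x' must control the tail seen from x, and SS12's x-avoiding / time-separated set-up must transport to arbitrary simple X_δ in a Jordan domain (CurveClass ℂ).
sources: SheffieldSun2012, Zhan2008Reversibility, KemppainenSmirnov2017, Karrila2024, Lawler2005
[crux] repaired PathUpgrade (the endpoint-only form = SheffieldSun2012 Cor 1.7 as literally stated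
was refuted ON PAPER 2026-08-17, REFUTATION.md on stmt-CriticalPhenomena-18005: N-curve / randomised
N-curve surgery on an SLE_8/3 sample): bidirectional Loewner upgrade WITH TWO-ENDPOINT TIGHTNESS.
Random simple curves X_δ in closure D from a = D.pt 0 to b = D.pt 1 (interior in D) under
eventually-probability laws P_δ such that (H4) the driving functions through a uniformizer φ of D
and (H5) the reversals' driving functions through a uniformizer φ' of D.swap both converge in law on
every [0,T] to √(8/3)B, (H6) no deep return to a (∀ ε η > 0 ∃ r > 0, eventually P_δ(X is ε-far from
a and later r-close to a) ≤ η) and (H7) no escape from b (∀ ε η ∃ r, eventually P_δ(X is r-close to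
b and later ε-far from b) ≤ η), converge in law in CurveClass ℂ to chordal SLE_8/3 in D
(`ConvergesInLawToSLE`). Believed true, NOT in print: SheffieldSun2012 Thm 1.4 / Cor 1.5 (R_x and
L_x convergence for a countable dense set of interior targets x, κ < 8) + the lemma 'chordal driving
convergence on every [0,T] + (H7) ⇒ radial R_x convergence in law for each interior x' (hull extent
at large capacity by Carat -/
@[route_item "route-CriticalPhenomena-SAWReversalUpgrade", crux]
def PathUpgradeR : Prop :=
  ∀ (D : Literature.Probability.RandomPlanarGeometry.DobrushinDomain) (φ : Literature.Probability.RandomPlanarGeometry.ConformalEquiv UpperHalfPlane.upperHalfPlaneSet D.carrier), D.IsChordalUniformizing φ → ∀ (φ' : Literature.Probability.RandomPlanarGeometry.ConformalEquiv UpperHalfPlane.upperHalfPlaneSet D.swap.carrier), D.swap.IsChordalUniformizing φ' → ∀ (Ω : ℝ → Type) [∀ δ, MeasurableSpace (Ω δ)] (X : (δ : ℝ) → Ω δ → Literature.Probability.RandomPlanarGeometry.Curve ℂ) (P : (δ : ℝ) → MeasureTheory.Measure (Ω δ)), (∀ᶠ δ in (nhdsWithin (0:ℝ) (Set.Ioi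 0)), MeasureTheory.IsProbabilityMeasure (P δ)) → (∀ᶠ δ in (nhdsWithin (0:ℝ) (Set.Ioi 0)), AEMeasurable (fun ω => Literature.Probability.RandomPlanarGeometry.CurveClass.mk (X δ ω)) (P δ)) → (∀ᶠ δ in (nhdsWithin (0:ℝ) (Set.Ioi 0)), ∀ ω : Ω δ, Function.Injective (X δ ω) ∧ (X δ ω).source = D.pt 0 ∧ (X δ ω).target = D.pt 1 ∧ ∀ t : unitInterval, X δ ω t = D.pt 0 ∨ X δ ω t = D.pt 1 ∨ X δ ω t ∈ D.carrier) → (∀ T : NNReal, Literature.Probability.RandomPlanarGeometry.TendstoLaw (fun δ (ω : Ω δ) => ((⟨Literature.Probability.RandomPlanarGeometry.drivingFunction (φ) (Literature.Probability.RandomPlanarGeometry.CurveClass.mk (X δ ω)), Literature.Probability.RandomPlanarGeometry.continuous_drivingFunction (φ) (Literature.Probability.RandomPlanarGeometry.CurveClass.mk (X δ ω))⟩ : C(NNReal, ℝ)).restrict (Set.Icc (0:NNReal) T))) P (fun ω : NNReal → ℝ => ((⟨Literature.Probability.RandomPlanarGeometry.sleDriving ((8:NNReal)/3) ω, Literature.Probability.RandomPlanarGeometry.continuous_sleDriving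 ((8:NNReal)/3) ω⟩ : C(NNReal, ℝ)).restrict (Set.Icc (0:NNReal) T))) Literature.Probability.Process.preWienerMeasure) → (∀ T : NNReal, Literature.Probability.RandomPlanarGeometry.TendstoLaw (fun δ (ω : Ω δ) => ((⟨Literature.Probability.RandomPlanarGeometry.drivingFunction (φ') ((Literature.Probability.RandomPlanarGeometry.CurveClass.mk (X δ ω)).reverse), Literature.Probability.RandomPlanarGeometry.continuous_drivingFunction (φ') ((Literature.Probability.RandomPlanarGeometry.CurveClass.mk (X δ ω)).reverse)⟩ : C(NNReal, ℝ)).restrict (Set.Icc (0:NNReal) T))) P (fun ω : NNReal → ℝ => ((⟨Literature.Probability.RandomPlanarGeometry.sleDriving ((8:NNReal)/3) ω, Literature.Probability.RandomPlanarGeometry.continuous_sleDriving ((8:NNReal)/3) ω⟩ : C(NNReal, ℝ)).restrict (Set.Icc (0:NNReal) T))) Literature.Probability.Process.preWienerMeasure) → (∀ ε : ℝ, 0 < ε → ∀ η : ℝ, 0 < η → ∃ r : ℝ, 0 < r ∧ ∀ᶠ δ in (nhdsWithin (0:ℝ) (Set.Ioi 0)), P δ {ω | ∃ s t : unitInterval,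 s < t ∧ ε ≤ dist (X δ ω s) (D.pt 0) ∧ dist (X δ ω t) (D.pt 0) ≤ r} ≤ ENNReal.ofReal η) → (∀ ε : ℝ, 0 < ε → ∀ η : ℝ, 0 < η → ∃ r : ℝ, 0 < r ∧ ∀ᶠ δ in (nhdsWithin (0:ℝ) (Set.Ioi 0)), P δ {ω | ∃ s t : unitInterval, s < t ∧ dist (X δ ω s) (D.pt 1) ≤ r ∧ ε ≤ dist (X δ ω t) (D.pt 1)} ≤ ENNReal.ofReal η) → Literature.Probability.RandomPlanarGeometry.ConvergesInLawToSLE ((8:NNReal)/3) D (fun δ (ω : Ω δ) => Literature.Probability.RandomPlanarGeometry.CurveClass.mk (X δ ω)) P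

/-- item stmt-CriticalPhenomena-18006 · support · rank 9 · closed · proved by Summit.CriticalPhenomena.SAWScalingLimit.Theorems.lawReversal_proof @ b5325d8714b8 (prover) · by planner
sources: LawlerSchrammWerner2004SAW
[support] exact time-reversal symmetry of the critical SAW law (the tree's `lawAt_map_sawReverse` at
x = x_c, barrier file SupercriticalSAWSpaceFillingReversible), in transport form: for every discrete
domain and every real function g on walks v → u, ∫ g d law(v→u) = ∫ g∘reverse d law(u→v) (reversal
is a weight-preserving bijection of DomainSAW: x_c^|γ^R| = x_c^|γ|). [difficulty: provable-now] -/
@[route_item "route-CriticalPhenomena-SAWReversalUpgrade", crux]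
def LawReversal : Prop :=
  ∀ (Ω : Set ℂ) (δ : ℝ) (u v : Literature.Probability.LatticeModels.Site 2) (g : Literature.Probability.RandomPlanarGeometry.SAW.DomainSAW Ω δ v u → ℝ), ∫ γ, g γ ∂(Literature.Probability.RandomPlanarGeometry.SAW.law Ω δ v u) = ∫ γ, g ⟨γ.walk.reverse, γ.isPath.reverse⟩ ∂(Literature.Probability.RandomPlanarGeometry.SAW.law Ω δ u v)

/-- item stmt-CriticalPhenomena-18007 · support · rank 9 · open · by planner
sources: LawlerSchrammWerner2004SAW, SheffieldSun2012
[support] reversal-equivariance of the canonical attachment: if c is standard for (D, φ) and the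
polyline of γ, and c' is standard for (D.swap, φ') and the polyline of the reversed walk, then mk c'
= reverse (mk c) in CurveClass ℂ (the angular squeeze commutes with z ↦ −1/z and with dilations;
uniformizers of D and D.swap differ by z ↦ −λ/z, `IsChordalUniformizing.exists_eq_trans_smul_holds`;
two injective curves with the same trace and endpoints define the same class). [difficulty:
provable-now] -/
@[route_item "route-CriticalPhenomena-SAWReversalUpgrade", crux]
def AttachReversal : Prop :=
  ∀ (D : Literature.Probability.RandomPlanarGeometry.DobrushinDomain) (φ : Literature.Probability.RandomPlanarGeometry.ConformalEquiv UpperHalfPlane.upperHalfPlaneSet D.carrier), D.IsChordalUniformizing φ → ∀ (φ' : Literature.Probability.RandomPlanarGeometry.ConformalEquiv UpperHalfPlane.upperHalfPlaneSet D.swap.carrier), D.swap.IsChordalUniformizing φ' → ∀ (δ : ℝ) (u v : Literature.Probability.LatticeModels.Site 2) (γ : Literature.Probability.RandomPlanarGeometry.SAW.DomainSAW D.carrier δ u v) (c c' : Literature.Probability.RandomPlanarGeometry.Curve ℂ), 0 < δ → (let a₁ := (D).pt 0; let b₁ := (D).pt 1; let P₁ : C(unitInterval, ℂ) := (γ.walk.toCurve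 (Literature.Probability.LatticeModels.meshPoint δ)); let R₁ := fun u : ℝ => P₁ (Set.projIcc (0:ℝ) 1 zero_le_one u); let φ₁ := (φ).boundaryExtension; let ψ₁ := Function.invFunOn φ₁ {z : ℂ | 0 ≤ z.im}; let e₁ : ℝ := min δ (1/2); let A₁ := fun z : ℂ => (‖z‖ : ℂ) * Complex.exp (Complex.I * ((e₁ : ℂ) + (1 - 2 * (e₁ : ℂ) / (Real.pi : ℂ)) * (Complex.arg z : ℂ))); let Z₁ := fun u : ℝ => @ite ℂ (R₁ u = b₁) (Classical.propDecidable _) b₁ (φ₁ (A₁ (ψ₁ (R₁ u)))); let i₁ := sSup ({(0:ℝ)} ∪ {u | u ∈ Set.Icc (0:ℝ) 1 ∧ R₁ u = a₁}); let j₁ := sInf ({(1:ℝ)} ∪ {u | u ∈ Set.Icc (0:ℝ) 1 ∧ R₁ u = b₁}); let M₁ := Z₁ '' Set.Icc i₁ j₁; let p₁ := A₁ (ψ₁ (R₁ i₁)); let q₁ := A₁ (ψ₁ (R₁ j₁)); let s₁ := sInf {s | s ∈ Set.Ioc (0:ℝ) 1 ∧ φ₁ ((s : ℂ) * p₁) ∈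 M₁}; let r₁ := sSup ({(1:ℝ)} ∪ {r | 1 ≤ r ∧ R₁ j₁ ≠ b₁ ∧ φ₁ ((r : ℂ) * q₁) ∈ M₁}); let u₁ := sInf {u | u ∈ Set.Icc i₁ j₁ ∧ Z₁ u = φ₁ ((s₁ : ℂ) * p₁)}; let v₁ := sSup ({u | u ∈ Set.Icc i₁ j₁ ∧ R₁ j₁ = b₁ ∧ u = j₁} ∪ {u | u ∈ Set.Icc i₁ j₁ ∧ R₁ j₁ ≠ b₁ ∧ Z₁ u = φ₁ ((r₁ : ℂ) * q₁)}); let S₁ := ((({a₁, b₁} ∪ ((fun s : ℝ => φ₁ ((s : ℂ) * p₁)) '' Set.Ioc 0 s₁)) ∪ (Z₁ '' Set.Icc u₁ v₁)) ∪ ((fun r : ℝ => φ₁ ((r : ℂ) * q₁)) '' {r | r₁ ≤ r ∧ R₁ j₁ ≠ b₁})); Function.Injective (c) ∧ (c).source = a₁ ∧ (c).target = b₁ ∧ (∀ t : unitInterval, (c) t = a₁ ∨ (c) t = b₁ ∨ (c) t ∈ (D).carrier) ∧ (u₁ < v₁ → Set.range (c) = S₁) ∧ (¬ u₁ < v₁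 → Set.range (c) = {a₁, b₁} ∪ ((fun y : ℝ => φ₁ (Complex.I * (y : ℂ))) '' Set.Ioi 0))) → (let a₁ := (D.swap).pt 0; let b₁ := (D.swap).pt 1; let P₁ : C(unitInterval, ℂ) := (γ.walk.reverse.toCurve (Literature.Probability.LatticeModels.meshPoint δ)); let R₁ := fun u : ℝ => P₁ (Set.projIcc (0:ℝ) 1 zero_le_one u); let φ₁ := (φ').boundaryExtension; let ψ₁ := Function.invFunOn φ₁ {z : ℂ | 0 ≤ z.im}; let e₁ : ℝ := min δ (1/2); let A₁ := fun z : ℂ => (‖z‖ : ℂ) * Complex.exp (Complex.I * ((e₁ : ℂ) + (1 - 2 * (e₁ : ℂ) / (Real.pi : ℂ)) * (Complex.arg z : ℂ))); let Z₁ := fun u : ℝ => @ite ℂ (R₁ u = b₁) (Classical.propDecidable _) b₁ (φ₁ (A₁ (ψ₁ (R₁ u)))); let i₁ := sSup ({(0:ℝ)} ∪ {u | u ∈ Set.Icc (0:ℝ) 1 ∧ R₁ u = a₁}); let j₁ := sInf ({(1:ℝ)} ∪ {u | u ∈ Set.Icc (0:ℝ) 1 ∧ R₁ u = b₁}); let M₁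 := Z₁ '' Set.Icc i₁ j₁; let p₁ := A₁ (ψ₁ (R₁ i₁)); let q₁ := A₁ (ψ₁ (R₁ j₁)); let s₁ := sInf {s | s ∈ Set.Ioc (0:ℝ) 1 ∧ φ₁ ((s : ℂ) * p₁) ∈ M₁}; let r₁ := sSup ({(1:ℝ)} ∪ {r | 1 ≤ r ∧ R₁ j₁ ≠ b₁ ∧ φ₁ ((r : ℂ) * q₁) ∈ M₁}); let u₁ := sInf {u | u ∈ Set.Icc i₁ j₁ ∧ Z₁ u = φ₁ ((s₁ : ℂ) * p₁)}; let v₁ := sSup ({u | u ∈ Set.Icc i₁ j₁ ∧ R₁ j₁ = b₁ ∧ u = j₁} ∪ {u | u ∈ Set.Icc i₁ j₁ ∧ R₁ j₁ ≠ b₁ ∧ Z₁ u = φ₁ ((r₁ : ℂ) * q₁)}); let S₁ := ((({a₁, b₁} ∪ ((fun s : ℝ => φ₁ ((s : ℂ) * p₁)) '' Set.Ioc 0 s₁)) ∪ (Z₁ '' Set.Icc u₁ v₁)) ∪ ((fun r : ℝ => φ₁ ((r : ℂ) * q₁)) '' {r | r₁ ≤ r ∧ R₁ j₁ ≠ b₁}));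 Function.Injective (c') ∧ (c').source = a₁ ∧ (c').target = b₁ ∧ (∀ t : unitInterval, (c') t = a₁ ∨ (c') t = b₁ ∨ (c') t ∈ (D.swap).carrier) ∧ (u₁ < v₁ → Set.range (c') = S₁) ∧ (¬ u₁ < v₁ → Set.range (c') = {a₁, b₁} ∪ ((fun y : ℝ => φ₁ (Complex.I * (y : ℂ))) '' Set.Ioi 0))) → Literature.Probability.RandomPlanarGeometry.CurveClass.mk c' = (Literature.Probability.RandomPlanarGeometry.CurveClass.mk c).reverse

/-- item stmt-CriticalPhenomena-18008 · support · rank 9 · closed · proved by Summit.CriticalPhenomena.SAWScalingLimit.Theorems.FaithfulOfNoReturn_proof @ d47eb328cb22 (prover) · by planner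
sources: SheffieldSun2012, Lawler2005
[support] under NoDeepReturn at a for (D; a, b) and at b (= NoDeepReturn at the start for D.swap),
the standard attachment is faithful: for every ε > 0 the SAW-probability that att(γ) and γ.curve are
ε-apart in CurveClass ℂ tends to 0 (trimmed and cut pieces are short; the squeeze A_(min δ 1/2)
tends to the identity uniformly on closure D by Carathéodory continuity). [difficulty: provable-now] -/
@[route_item "route-CriticalPhenomena-SAWReversalUpgrade", crux]
def FaithfulOfNoReturn : Prop :=
  ∀ (D : Literature.Probability.RandomPlanarGeometry.DobrushinDomain) (a b : ℝ → Literature.Probability.LatticeModels.Site 2), Literature.Probability.RandomPlanarGeometry.SAW.IsEndpointApprox D a b → ∀ (φ : Literature.Probability.RandomPlanarGeometry.ConformalEquiv UpperHalfPlane.upperHalfPlaneSet D.carrier), D.IsChordalUniformizing φ → ∀ (att : ((δ : ℝ) → Literature.Probability.RandomPlanarGeometry.SAW.DomainSAW (D).carrier δ (a δ) (b δ) → Literature.Probability.RandomPlanarGeometry.Curve ℂ)), (∀ᶠ δ in (nhdsWithin (0:ℝ) (Set.Ioi 0)), ∀ γ : Literature.Probability.RandomPlanarGeometry.SAW.DomainSAW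 (D).carrier δ (a δ) (b δ), (let a₁ := (D).pt 0; let b₁ := (D).pt 1; let P₁ : C(unitInterval, ℂ) := (γ.walk.toCurve (Literature.Probability.LatticeModels.meshPoint δ)); let R₁ := fun u : ℝ => P₁ (Set.projIcc (0:ℝ) 1 zero_le_one u); let φ₁ := (φ).boundaryExtension; let ψ₁ := Function.invFunOn φ₁ {z : ℂ | 0 ≤ z.im}; let e₁ : ℝ := min δ (1/2); let A₁ := fun z : ℂ => (‖z‖ : ℂ) * Complex.exp (Complex.I * ((e₁ : ℂ) + (1 - 2 * (e₁ : ℂ) / (Real.pi : ℂ)) * (Complex.arg z : ℂ))); let Z₁ := fun u : ℝ => @ite ℂ (R₁ u = b₁) (Classical.propDecidable _) b₁ (φ₁ (A₁ (ψ₁ (R₁ u)))); let i₁ := sSup ({(0:ℝ)} ∪ {u | u ∈ Set.Icc (0:ℝ) 1 ∧ R₁ u = a₁}); let j₁ := sInf ({(1:ℝ)} ∪ {u | u ∈ Set.Icc (0:ℝ) 1 ∧ R₁ u = b₁}); let M₁ := Z₁ '' Set.Icc i₁ j₁; let p₁ := A₁ (ψ₁ (R₁ i₁)); let q₁ := A₁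 (ψ₁ (R₁ j₁)); let s₁ := sInf {s | s ∈ Set.Ioc (0:ℝ) 1 ∧ φ₁ ((s : ℂ) * p₁) ∈ M₁}; let r₁ := sSup ({(1:ℝ)} ∪ {r | 1 ≤ r ∧ R₁ j₁ ≠ b₁ ∧ φ₁ ((r : ℂ) * q₁) ∈ M₁}); let u₁ := sInf {u | u ∈ Set.Icc i₁ j₁ ∧ Z₁ u = φ₁ ((s₁ : ℂ) * p₁)}; let v₁ := sSup ({u | u ∈ Set.Icc i₁ j₁ ∧ R₁ j₁ = b₁ ∧ u = j₁} ∪ {u | u ∈ Set.Icc i₁ j₁ ∧ R₁ j₁ ≠ b₁ ∧ Z₁ u = φ₁ ((r₁ : ℂ) * q₁)}); let S₁ := ((({a₁, b₁} ∪ ((fun s : ℝ => φ₁ ((s : ℂ) * p₁)) '' Set.Ioc 0 s₁)) ∪ (Z₁ '' Set.Icc u₁ v₁)) ∪ ((fun r : ℝ => φ₁ ((r : ℂ) * q₁)) '' {r | r₁ ≤ r ∧ R₁ j₁ ≠ b₁})); Function.Injective (att δ γ) ∧ (att δ γ).source = a₁ ∧ (att δ γ).target = b₁ ∧ (∀ t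 : unitInterval, (att δ γ) t = a₁ ∨ (att δ γ) t = b₁ ∨ (att δ γ) t ∈ (D).carrier) ∧ (u₁ < v₁ → Set.range (att δ γ) = S₁) ∧ (¬ u₁ < v₁ → Set.range (att δ γ) = {a₁, b₁} ∪ ((fun y : ℝ => φ₁ (Complex.I * (y : ℂ))) '' Set.Ioi 0)))) → (∀ ε : ℝ, 0 < ε → ∀ η : ℝ, 0 < η → ∃ r : ℝ, 0 < r ∧ ∀ᶠ δ in (nhdsWithin (0:ℝ) (Set.Ioi 0)), Literature.Probability.RandomPlanarGeometry.SAW.law (D).carrier δ (a δ) (b δ) {γ | ∃ s t : unitInterval, s < t ∧ ε ≤ dist (γ.walk.toCurve (Literature.Probability.LatticeModels.meshPoint δ) s) ((D).pt 0) ∧ dist (γ.walk.toCurve (Literature.Probability.LatticeModels.meshPoint δ) t) ((D).pt 0) ≤ r} ≤ ENNReal.ofReal η) → (∀ ε : ℝ, 0 < ε → ∀ η : ℝ, 0 < η → ∃ r : ℝ, 0 < r ∧ ∀ᶠ δ in (nhdsWithin (0:ℝ) (Set.Ioi 0)), Literature.Probability.RandomPlanarGeometry.SAW.law (D.swap).carrier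 δ (b δ) (a δ) {γ | ∃ s t : unitInterval, s < t ∧ ε ≤ dist (γ.walk.toCurve (Literature.Probability.LatticeModels.meshPoint δ) s) ((D.swap).pt 0) ∧ dist (γ.walk.toCurve (Literature.Probability.LatticeModels.meshPoint δ) t) ((D.swap).pt 0) ≤ r} ≤ ENNReal.ofReal η) → ∀ ε : ℝ, 0 < ε → Filter.Tendsto (fun δ : ℝ => (Literature.Probability.RandomPlanarGeometry.SAW.law D.carrier δ (a δ) (b δ) {γ | ε ≤ dist (Literature.Probability.RandomPlanarGeometry.CurveClass.mk (att δ γ)) γ.curve}).toReal) (nhdsWithin (0:ℝ) (Set.Ioi 0)) (nhds 0)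

/-- item stmt-CriticalPhenomena-18009 · support · rank 9 · closed · proved by Summit.CriticalPhenomena.SAWScalingLimit.Theorems.attachmentExists_proof @ 2fe1809e2a44 (prover) · by planner
sources: Lawler2005, SheffieldSun2012
[support] for every Dobrushin domain, uniformizer and endpoint approximation there is an attachment
att that is standard for all small δ (the prescribed range is a simple arc from D.pt 0 to D.pt 1
with interior in D; parametrise it injectively). [difficulty: provable-now] -/
@[route_item "route-CriticalPhenomena-SAWReversalUpgrade", crux]
def AttachmentExists : Prop :=
  ∀ (D : Literature.Probability.RandomPlanarGeometry.DobrushinDomain) (φ : Literature.Probability.RandomPlanarGeometry.ConformalEquiv UpperHalfPlane.upperHalfPlaneSet D.carrier), D.IsChordalUniformizing φ → ∀ (a b : ℝ → Literature.Probability.LatticeModels.Site 2), Literature.Probability.RandomPlanarGeometry.SAW.IsEndpointApprox D a b → ∃ att : ((δ : ℝ) → Literature.Probability.RandomPlanarGeometry.SAW.DomainSAW (D).carrier δ (a δ) (b δ) → Literature.Probability.RandomPlanarGeometry.Curve ℂ), (∀ᶠ δ in (nhdsWithin (0:ℝ) (Set.Ioi 0)), ∀ γ : Literature.Probability.RandomPlanarGeometry.SAW.DomainSAW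 (D).carrier δ (a δ) (b δ), (let a₁ := (D).pt 0; let b₁ := (D).pt 1; let P₁ : C(unitInterval, ℂ) := (γ.walk.toCurve (Literature.Probability.LatticeModels.meshPoint δ)); let R₁ := fun u : ℝ => P₁ (Set.projIcc (0:ℝ) 1 zero_le_one u); let φ₁ := (φ).boundaryExtension; let ψ₁ := Function.invFunOn φ₁ {z : ℂ | 0 ≤ z.im}; let e₁ : ℝ := min δ (1/2); let A₁ := fun z : ℂ => (‖z‖ : ℂ) * Complex.exp (Complex.I * ((e₁ : ℂ) + (1 - 2 * (e₁ : ℂ) / (Real.pi : ℂ)) * (Complex.arg z : ℂ))); let Z₁ := fun u : ℝ => @ite ℂ (R₁ u = b₁) (Classical.propDecidable _) b₁ (φ₁ (A₁ (ψ₁ (R₁ u)))); let i₁ := sSup ({(0:ℝ)} ∪ {u | u ∈ Set.Icc (0:ℝ) 1 ∧ R₁ u = a₁}); let j₁ := sInf ({(1:ℝ)} ∪ {u | u ∈ Set.Icc (0:ℝ) 1 ∧ R₁ u = b₁}); let M₁ := Z₁ '' Set.Icc i₁ j₁; let p₁ := A₁ (ψ₁ (R₁ i₁)); let q₁ := A₁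 (ψ₁ (R₁ j₁)); let s₁ := sInf {s | s ∈ Set.Ioc (0:ℝ) 1 ∧ φ₁ ((s : ℂ) * p₁) ∈ M₁}; let r₁ := sSup ({(1:ℝ)} ∪ {r | 1 ≤ r ∧ R₁ j₁ ≠ b₁ ∧ φ₁ ((r : ℂ) * q₁) ∈ M₁}); let u₁ := sInf {u | u ∈ Set.Icc i₁ j₁ ∧ Z₁ u = φ₁ ((s₁ : ℂ) * p₁)}; let v₁ := sSup ({u | u ∈ Set.Icc i₁ j₁ ∧ R₁ j₁ = b₁ ∧ u = j₁} ∪ {u | u ∈ Set.Icc i₁ j₁ ∧ R₁ j₁ ≠ b₁ ∧ Z₁ u = φ₁ ((r₁ : ℂ) * q₁)}); let S₁ := ((({a₁, b₁} ∪ ((fun s : ℝ => φ₁ ((s : ℂ) * p₁)) '' Set.Ioc 0 s₁)) ∪ (Z₁ '' Set.Icc u₁ v₁)) ∪ ((fun r : ℝ => φ₁ ((r : ℂ) * q₁)) '' {r | r₁ ≤ r ∧ R₁ j₁ ≠ b₁})); Function.Injective (att δ γ) ∧ (att δ γ).source = a₁ ∧ (att δ γ).target = b₁ ∧ (∀ t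 : unitInterval, (att δ γ) t = a₁ ∨ (att δ γ) t = b₁ ∨ (att δ γ) t ∈ (D).carrier) ∧ (u₁ < v₁ → Set.range (att δ γ) = S₁) ∧ (¬ u₁ < v₁ → Set.range (att δ γ) = {a₁, b₁} ∪ ((fun y : ℝ => φ₁ (Complex.I * (y : ℂ))) '' Set.Ioi 0))))

/-- item stmt-CriticalPhenomena-18010 · support · rank 9 · closed · proved by Summit.CriticalPhenomena.SAWScalingLimit.Theorems.lawTransfer_proof @ cb6848f1975b (prover) · by planner
sources: Lawler2005, KemppainenSmirnov2017
[support] Slutsky on CurveClass ℂ: if X_δ → SLE_κ in law (`ConvergesInLawToSLE`) and dist(X_δ, Y_δ)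
→ 0 in P_δ-probability (P_δ eventually probability, Y_δ eventually a.e.-measurable) then Y_δ → SLE_κ
in law. [difficulty: provable-now] -/
@[route_item "route-CriticalPhenomena-SAWReversalUpgrade", crux]
def LawTransfer : Prop :=
  ∀ (κ : NNReal) (D : Literature.Probability.RandomPlanarGeometry.DobrushinDomain) (Ω : ℝ → Type) [∀ δ, MeasurableSpace (Ω δ)] (X Y : (δ : ℝ) → Ω δ → Literature.Probability.RandomPlanarGeometry.CurveClass ℂ) (P : (δ : ℝ) → MeasureTheory.Measure (Ω δ)), (∀ᶠ δ in (nhdsWithin (0:ℝ) (Set.Ioi 0)), MeasureTheory.IsProbabilityMeasure (P δ)) → (∀ᶠ δ in (nhdsWithin (0:ℝ) (Set.Ioi 0)), AEMeasurable (Y δ) (P δ)) → (∀ ε : ℝ, 0 < ε → Filter.Tendsto (fun δ : ℝ => ((P δ) {ω | ε ≤ dist (X δ ω) (Y δ ω)}).toReal) (nhdsWithin (0:ℝ) (Set.Ioi 0)) (nhds 0)) → Literature.Probability.RandomPlanarGeometry.ConvergesInLawToSLE κ D X P → Literature.Probability.RandomPlanarGeometry.ConvergesInLawToSLE κ D Y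 P

/-- item stmt-CriticalPhenomena-18011 · support · rank 9 · closed · proved by Summit.CriticalPhenomena.SAWScalingLimit.Theorems.LawEventuallyProbability_proof @ 6979458aba67 (prover) · by planner
sources: LawlerSchrammWerner2004SAW, DuminilCopinSmirnov2012
[support] for all small δ the critical SAW law of Ω_δ from a_δ to b_δ is a probability measure
(endpoints joined ⇒ positive finite weight; proved inline in route SAWRenewalTightness' deciding
theorem, to be banked as a lemma). [difficulty: provable-now] -/
@[route_item "route-CriticalPhenomena-SAWReversalUpgrade", crux]
def LawEventuallyProbability : Prop :=
  ∀ (D : Literature.Probability.RandomPlanarGeometry.DobrushinDomain) (a b : ℝ → Literature.Probability.LatticeModels.Site 2), Literature.Probability.RandomPlanarGeometry.SAW.IsEndpointApprox D a b → ∀ᶠ δ in (nhdsWithin (0:ℝ) (Set.Ioi 0)), MeasureTheory.IsProbabilityMeasure (Literature.Probability.RandomPlanarGeometry.SAW.law D.carrier δ (a δ) (b δ))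

/-- item stmt-CriticalPhenomena-18012 · support · rank 9 · closed · proved by Summit.CriticalPhenomena.SAWScalingLimit.Theorems.EndpointApproxSwap_proof @ 2311afa2f3b7 (prover) · by planner
sources: LawlerSchrammWerner2004SAW
[support] an endpoint approximation of (D; a, b) is an endpoint approximation of (D.swap; b, a)
(reachability is symmetric; `pt_swap_zero/one`). [difficulty: provable-now] -/
@[route_item "route-CriticalPhenomena-SAWReversalUpgrade", crux]
def EndpointApproxSwap : Prop :=
  ∀ (D : Literature.Probability.RandomPlanarGeometry.DobrushinDomain) (a b : ℝ → Literature.Probability.LatticeModels.Site 2), Literature.Probability.RandomPlanarGeometry.SAW.IsEndpointApprox D a b → Literature.Probability.RandomPlanarGeometry.SAW.IsEndpointApprox D.swap b a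

/-- item stmt-CriticalPhenomena-18057 · support · rank 9 · closed · proved by Summit.CriticalPhenomena.SAWScalingLimit.Theorems.attachNoReturn_proof @ 8b41234b531f (prover) · by planner
sources: Lawler2005, SheffieldSun2012, LawlerSchrammWerner2004SAW
[support] endpoint tightness passes to the attached curve: under NoDeepReturn at a for (D; a, b) and
at b = D.swap.pt 0 for (D.swap; b, a) (the same two hypotheses FaithfulOfNoReturn takes; reversed
walks have the same law, x_c^|γ^R| = x_c^|γ|, `lawAt_map_sawReverse`), every eventually-standard
attachment att satisfies, for every ε η > 0, some r > 0 and all small δ: SAW-probability ≤ η that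
att(γ) is ε-far from a and later r-close to a (H6), and ≤ η that att(γ) is r-close to b and later
ε-far from b (H7). Proof sketch: the access segment lies in B(a, o(1)) and the exit ray in B(b,
o(1)) (meshPoint δ (a δ) → a, Carathéodory continuity of φ.boundaryExtension and its inverse at 0/a
and ∞/b); the squeeze displacement sup |φ(A_ε w) − φ(w)| → 0 uniformly on closure ℍ; the attached
arc is traversed in polyline order, so an (ε, r)-event for att(γ) is an (ε/2, 2r)-event for the
polyline (at a) or for the reversed polyline (at b); the fallback arc φ(iℝ₊) has no such event for
small r. Feeds (H6),(H7) of PathUpgradeR in `closes`. [difficulty: provable-now] -/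
@[route_item "route-CriticalPhenomena-SAWReversalUpgrade", crux]
def AttachNoReturn : Prop :=
  ∀ (D : Literature.Probability.RandomPlanarGeometry.DobrushinDomain) (a b : ℝ → Literature.Probability.LatticeModels.Site 2), Literature.Probability.RandomPlanarGeometry.SAW.IsEndpointApprox D a b → ∀ (φ : Literature.Probability.RandomPlanarGeometry.ConformalEquiv UpperHalfPlane.upperHalfPlaneSet D.carrier), D.IsChordalUniformizing φ → ∀ (att : ((δ : ℝ) → Literature.Probability.RandomPlanarGeometry.SAW.DomainSAW (D).carrier δ (a δ) (b δ) → Literature.Probability.RandomPlanarGeometry.Curve ℂ)), (∀ᶠ δ in (nhdsWithin (0:ℝ) (Set.Ioi 0)), ∀ γ : Literature.Probability.RandomPlanarGeometry.SAW.DomainSAW (D).carrier δ (a δ) (b δ), (let a₁ := (D).pt 0; let b₁ := (D).pt 1; let P₁ : C(unitInterval, ℂ) := (γ.walk.toCurve (Literature.Probability.LatticeModels.meshPoint δ)); let R₁ := fun u : ℝ => P₁ (Set.projIcc (0:ℝ) 1 zero_le_one u); let φ₁ := (φ).boundaryExtension; let ψ₁ := Function.invFunOn φ₁ {z : ℂ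 | 0 ≤ z.im}; let e₁ : ℝ := min δ (1/2); let A₁ := fun z : ℂ => (‖z‖ : ℂ) * Complex.exp (Complex.I * ((e₁ : ℂ) + (1 - 2 * (e₁ : ℂ) / (Real.pi : ℂ)) * (Complex.arg z : ℂ))); let Z₁ := fun u : ℝ => @ite ℂ (R₁ u = b₁) (Classical.propDecidable _) b₁ (φ₁ (A₁ (ψ₁ (R₁ u)))); let i₁ := sSup ({(0:ℝ)} ∪ {u | u ∈ Set.Icc (0:ℝ) 1 ∧ R₁ u = a₁}); let j₁ := sInf ({(1:ℝ)} ∪ {u | u ∈ Set.Icc (0:ℝ) 1 ∧ R₁ u = b₁}); let M₁ := Z₁ '' Set.Icc i₁ j₁; let p₁ := A₁ (ψ₁ (R₁ i₁)); let q₁ := A₁ (ψ₁ (R₁ j₁)); let s₁ := sInf {s | s ∈ Set.Ioc (0:ℝ) 1 ∧ φ₁ ((s : ℂ) * p₁) ∈ M₁}; let r₁ := sSup ({(1:ℝ)} ∪ {r | 1 ≤ r ∧ R₁ j₁ ≠ b₁ ∧ φ₁ ((r : ℂ) * q₁) ∈ M₁}); let u₁ := sInf {u | u ∈ Set.Icc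 i₁ j₁ ∧ Z₁ u = φ₁ ((s₁ : ℂ) * p₁)}; let v₁ := sSup ({u | u ∈ Set.Icc i₁ j₁ ∧ R₁ j₁ = b₁ ∧ u = j₁} ∪ {u | u ∈ Set.Icc i₁ j₁ ∧ R₁ j₁ ≠ b₁ ∧ Z₁ u = φ₁ ((r₁ : ℂ) * q₁)}); let S₁ := ((({a₁, b₁} ∪ ((fun s : ℝ => φ₁ ((s : ℂ) * p₁)) '' Set.Ioc 0 s₁)) ∪ (Z₁ '' Set.Icc u₁ v₁)) ∪ ((fun r : ℝ => φ₁ ((r : ℂ) * q₁)) '' {r | r₁ ≤ r ∧ R₁ j₁ ≠ b₁})); Function.Injective (att δ γ) ∧ (att δ γ).source = a₁ ∧ (att δ γ).target = b₁ ∧ (∀ t : unitInterval, (att δ γ) t = a₁ ∨ (att δ γ) t = b₁ ∨ (att δ γ) t ∈ (D).carrier) ∧ (u₁ < v₁ → Set.range (att δ γ) = S₁) ∧ (¬ u₁ < v₁ → Set.range (att δ γ) = {a₁, b₁} ∪ ((fun y : ℝ => φ₁ (Complex.I * (y : ℂ))) '' Set.Ioi 0)))) → (∀ ε : ℝ, 0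 < ε → ∀ η : ℝ, 0 < η → ∃ r : ℝ, 0 < r ∧ ∀ᶠ δ in (nhdsWithin (0:ℝ) (Set.Ioi 0)), Literature.Probability.RandomPlanarGeometry.SAW.law (D).carrier δ (a δ) (b δ) {γ | ∃ s t : unitInterval, s < t ∧ ε ≤ dist (γ.walk.toCurve (Literature.Probability.LatticeModels.meshPoint δ) s) ((D).pt 0) ∧ dist (γ.walk.toCurve (Literature.Probability.LatticeModels.meshPoint δ) t) ((D).pt 0) ≤ r} ≤ ENNReal.ofReal η) → (∀ ε : ℝ, 0 < ε → ∀ η : ℝ, 0 < η → ∃ r : ℝ, 0 < r ∧ ∀ᶠ δ in (nhdsWithin (0:ℝ) (Set.Ioi 0)), Literature.Probability.RandomPlanarGeometry.SAW.law (D.swap).carrier δ (b δ) (a δ) {γ | ∃ s t : unitInterval, s < t ∧ ε ≤ dist (γ.walk.toCurve (Literature.Probability.LatticeModels.meshPoint δ) s) ((D.swap).pt 0) ∧ dist (γ.walk.toCurve (Literature.Probability.LatticeModels.meshPoint δ) t) ((D.swap).pt 0) ≤ r} ≤ ENNReal.ofReal η) → (∀ ε : ℝ, 0 < ε → ∀ η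 : ℝ, 0 < η → ∃ r : ℝ, 0 < r ∧ ∀ᶠ δ in (nhdsWithin (0:ℝ) (Set.Ioi 0)), Literature.Probability.RandomPlanarGeometry.SAW.law D.carrier δ (a δ) (b δ) {γ | ∃ s t : unitInterval, s < t ∧ ε ≤ dist ((att δ γ) s) (D.pt 0) ∧ dist ((att δ γ) t) (D.pt 0) ≤ r} ≤ ENNReal.ofReal η) ∧ (∀ ε : ℝ, 0 < ε → ∀ η : ℝ, 0 < η → ∃ r : ℝ, 0 < r ∧ ∀ᶠ δ in (nhdsWithin (0:ℝ) (Set.Ioi 0)), Literature.Probability.RandomPlanarGeometry.SAW.law D.carrier δ (a δ) (b δ) {γ | ∃ s t : unitInterval, s < t ∧ dist ((att δ γ) s) (D.pt 1) ≤ r ∧ ε ≤ dist ((att δ γ) t) (D.pt 1)} ≤ ENNReal.ofReal η)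

-- earlier Assembly (stmt-CriticalPhenomena-18013, replaced 2026-08-17T07:31:06Z -> stmt-CriticalPhenomena-18056): retired by None — ForwardDriving → PathUpgrade → NoDeepReturn → LawReversal → AttachReversal → FaithfulOfNoReturn → AttachmentExists → LawTransfer → LawEventuallyProbability → EndpointApproxSwap → _root_.SAWScalingLimit
/-- item stmt-CriticalPhenomena-18056 · assembly · rank 1 · open · by planner
sources: SheffieldSun2012, LawlerSchrammWerner2004SAW
[assembly] ForwardDriving → PathUpgradeR → NoDeepReturn → LawReversal → AttachReversal →
FaithfulOfNoReturn → AttachNoReturn → AttachmentExists → LawTransfer → LawEventuallyProbability →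
EndpointApproxSwap → SAWScalingLimit (= the deciding theorem `closes` re-packaged; revised
2026-08-17 with the PathUpgrade repair). -/
@[route_item "route-CriticalPhenomena-SAWReversalUpgrade"]
def Assembly : Prop :=
  ForwardDriving → PathUpgradeR → NoDeepReturn → LawReversal → AttachReversal → FaithfulOfNoReturn → AttachNoReturn → AttachmentExists → LawTransfer → LawEventuallyProbability → EndpointApproxSwap → _root_.SAWScalingLimit

-- records of items no longer active in this route (dropped / restated):
-- earlier PathUpgrade (stmt-CriticalPhenomena-18005, replaced 2026-08-17T07:31:06Z -> stmt-CriticalPhenomena-18055): retired by None — ∀ (D : Literature.Probability.RandomPlanarGeometry.DobrushinDomain) (φ : Literature.Probability.RandomPlanarGeometry.ConformalEquiv UpperHalfPlane.upperHalfPlaneSet D.carrier), D.IsChordalUniformizing φ → ∀ (φ' : Literature.Probability.RandomPlanarGeometry.ConformalE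

/-! D-0027 §2.1 — DECIDING THEOREM (planner-authored via `route open/edit --closes-file`; by planner-rrefute-CriticalPhenomena-SAWReversalU-75a70f8b-0 2026-08-17T07:31:06Z):
its hypotheses are this route's items and its conclusion the sub-problem Statement (glue_lint), and it elaborates with this file. -/

@[closes "route-CriticalPhenomena-SAWReversalUpgrade"] theorem closes (hK1 : ForwardDriving) (hK2 : PathUpgradeR) (hK3 : NoDeepReturn)
    (hS1 : LawReversal) (hS1b : AttachReversal) (hS2 : FaithfulOfNoReturn) (hS2b : AttachNoReturn)
    (hS3 : AttachmentExists) (hS4 : LawTransfer) (hS5 : LawEventuallyProbability)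
    (hS6 : EndpointApproxSwap) :
    _root_.SAWScalingLimit := by
  intro D a b happ
  obtain ⟨φ, hφ⟩ :=
    Literature.Probability.RandomPlanarGeometry.MarkedDomain.exists_isChordalUniformizing_holds D
  obtain ⟨φ', hφ'⟩ :=
    Literature.Probability.RandomPlanarGeometry.MarkedDomain.exists_isChordalUniformizing_holds D.swap
  have happ' : Literature.Probability.RandomPlanarGeometry.SAW.IsEndpointApprox D.swap b a := hS6 D a b happ
  obtain ⟨att, hatt⟩ := hS3 D φ hφ a b happ
  obtain ⟨att', hatt'⟩ := hS3 D.swap φ' hφ' b a happ'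
  have hF := hK1 D a b happ φ hφ att hatt
  have hF' := hK1 D.swap b a happ' φ' hφ' att' hatt'
  -- the reversal step: backward driving convergence of `att` from forward convergence in `D.swap`
  have hB : ∀ T : NNReal, Literature.Probability.RandomPlanarGeometry.TendstoLaw
      (fun δ (γ : Literature.Probability.RandomPlanarGeometry.SAW.DomainSAW D.carrier δ (a δ) (b δ)) =>
        ((⟨Literature.Probability.RandomPlanarGeometry.drivingFunction φ' (Literature.Probability.RandomPlanarGeometry.CurveClass.mk (att δ γ)).reverse,
           Literature.Probability.RandomPlanarGeometry.continuous_drivingFunction φ' (Literature.Probability.RandomPlanarGeometry.CurveClass.mk (att δ γ)).reverse⟩ :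
            C(NNReal, ℝ)).restrict (Set.Icc (0:NNReal) T)))
      (fun δ => Literature.Probability.RandomPlanarGeometry.SAW.law D.carrier δ (a δ) (b δ))
      (fun ω : NNReal → ℝ => ((⟨Literature.Probability.RandomPlanarGeometry.sleDriving ((8:NNReal)/3) ω,
        Literature.Probability.RandomPlanarGeometry.continuous_sleDriving ((8:NNReal)/3) ω⟩ : C(NNReal, ℝ)).restrict (Set.Icc (0:NNReal) T)))
      Literature.Probability.Process.preWienerMeasure := by
    intro T f
    have h := hF' T f
    refine h.congr' ?_
    have hpos : ∀ᶠ δ in nhdsWithin (0:ℝ) (Set.Ioi 0), (0:ℝ) < δ := self_mem_nhdsWithin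
    filter_upwards [hatt, hatt', hpos] with δ h1 h2 hδ
    let F : Literature.Probability.RandomPlanarGeometry.CurveClass ℂ → ℝ := fun X =>
      f (((⟨Literature.Probability.RandomPlanarGeometry.drivingFunction φ' X, Literature.Probability.RandomPlanarGeometry.continuous_drivingFunction φ' X⟩ :
        C(NNReal, ℝ)).restrict (Set.Icc (0:NNReal) T)))
    have e1 := hS1 D.carrier δ (a δ) (b δ) (fun γ' => F (Literature.Probability.RandomPlanarGeometry.CurveClass.mk (att' δ γ')))
    refine e1.trans ?_
    refine MeasureTheory.integral_congr_ae (Filter.Eventually.of_forall fun γ => ?_)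
    have e2 := hS1b D φ hφ φ' hφ' δ (a δ) (b δ) γ (att δ γ)
      (att' δ ⟨γ.walk.reverse, γ.isPath.reverse⟩) hδ (h1 γ) (h2 ⟨γ.walk.reverse, γ.isPath.reverse⟩)
    exact congrArg F e2
  have hprob := hS5 D a b happ
  have hmeasX : ∀ᶠ δ in nhdsWithin (0:ℝ) (Set.Ioi 0), AEMeasurable
      (fun γ : Literature.Probability.RandomPlanarGeometry.SAW.DomainSAW D.carrier δ (a δ) (b δ) =>
        Literature.Probability.RandomPlanarGeometry.CurveClass.mk (att δ γ))
      (Literature.Probability.RandomPlanarGeometry.SAW.law D.carrier δ (a δ) (b δ)) :=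
    Filter.Eventually.of_forall fun δ =>
      (Literature.Probability.RandomPlanarGeometry.SAW.DomainSAW.measurable_of_top _).aemeasurable
  have hstd : ∀ᶠ δ in nhdsWithin (0:ℝ) (Set.Ioi 0),
      ∀ γ : Literature.Probability.RandomPlanarGeometry.SAW.DomainSAW D.carrier δ (a δ) (b δ),
        Function.Injective (att δ γ) ∧ (att δ γ).source = D.pt 0 ∧ (att δ γ).target = D.pt 1 ∧
        ∀ t : unitInterval, att δ γ t = D.pt 0 ∨ att δ γ t = D.pt 1 ∨ att δ γ t ∈ D.carrier :=
    hatt.mono fun δ h γ => ⟨(h γ).1, (h γ).2.1, (h γ).2.2.1, (h γ).2.2.2.1⟩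
  -- endpoint tightness of `att` (no deep return to `a`, no escape from `b`) from NoDeepReturn in `D` and `D.swap`
  have hnr := hS2b D a b happ φ hφ att hatt (hK3 D a b happ) (hK3 D.swap b a happ')
  have hconv := hK2 D φ hφ φ' hφ'
    (fun δ => Literature.Probability.RandomPlanarGeometry.SAW.DomainSAW D.carrier δ (a δ) (b δ))
    (fun δ γ => att δ γ)
    (fun δ => Literature.Probability.RandomPlanarGeometry.SAW.law D.carrier δ (a δ) (b δ))
    hprob hmeasX hstd hF hB hnr.1 hnr.2
  have hfaith := hS2 D a b happ φ hφ att hatt (hK3 D a b happ) (hK3 D.swap b a happ')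
  exact hS4 ((8:NNReal)/3) D
    (fun δ => Literature.Probability.RandomPlanarGeometry.SAW.DomainSAW D.carrier δ (a δ) (b δ))
    (fun δ γ => Literature.Probability.RandomPlanarGeometry.CurveClass.mk (att δ γ))
    (fun δ γ => γ.curve)
    (fun δ => Literature.Probability.RandomPlanarGeometry.SAW.law D.carrier δ (a δ) (b δ))
    hprob (Filter.Eventually.of_forall fun δ =>
      Literature.Probability.RandomPlanarGeometry.SAW.aemeasurable_curve _ _ _ _) hfaith hconv

end Summit.CriticalPhenomena.SAWScalingLimit.Theses.SAWReversalUpgrade
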